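import Summits.Ventures.QEC.Census.CertChunks
import Summits.Ventures.QEC.Census.LP.LP36w5.Cert
import HarnessLib

/-!
# `LP36w5` — KERNEL-tier lower-bound replay, side Z, leaf file 1/1 (emitted by qec-search-7)

Bruteforce replay (CERT-FORMAT v1 §5.1, lemma L3) of the certificate `371103695c3e0abc`: every Z-type operator of weight
`1 … 5` has nonzero syndrome (rows `cert.HX`) or is allow-listed (allow-list [1090781187, 34904997921, 2181562374, 4363124748, 8726249496, 17452498992, 17247240384, 8631879744, 34494480768, 1343226624, 2686453248, 4315941888, 4563677184, 2290225152, 9127354368, 17197744128, 34395488256, 1145241600]). This file holds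
3 packed chunk evaluations (`chunk1R`/`chunk2R` of `Census/CertChunks.lean` over `posList 36 cert.HX`), total
443703 scan end points, each closed by `decide +kernel` — tier KERNEL (CERTIFIED): axioms ⊆ {propext, Classical.choice,
Quot.sound}. Assembled in `LP/LP36w5/KernelZ.lean`. Do not edit; re-emit (HOME/census/search-7/emit_kernel.py).
-/

namespace Summit.Ventures.QEC.Census.LP36w5

/-- Level-1 chunks `i`, `0 ≤ i < 3`, side Z of `LP36w5` (159430 end points): pass. -/
theorem kZ1_0 : chunk1R (leafTest [1090781187, 34904997921, 2181562374, 4363124748, 8726249496, 17452498992, 17247240384, 8631879744, 34494480768, 1343226624, 2686453248, 4315941888, 4563677184, 2290225152, 9127354368, 17197744128, 34395488256, 1145241600]) (posList 36 cert.HX) 4 0 3 = true := by decide +kernel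

/-- Level-1 chunks `i`, `3 ≤ i < 9`, side Z of `LP36w5` (182690 end points): pass. -/
theorem kZ1_3 : chunk1R (leafTest [1090781187, 34904997921, 2181562374, 4363124748, 8726249496, 17452498992, 17247240384, 8631879744, 34494480768, 1343226624, 2686453248, 4315941888, 4563677184, 2290225152, 9127354368, 17197744128, 34395488256, 1145241600]) (posList 36 cert.HX) 4 3 6 = true := by decide +kernel

/-- Level-1 chunks `i`, `9 ≤ i < 36`, side Z of `LP36w5` (101583 end points): pass. -/
theorem kZ1_9 : chunk1R (leafTest [1090781187, 34904997921, 2181562374, 4363124748, 8726249496, 17452498992, 17247240384, 8631879744, 34494480768, 1343226624, 2686453248, 4315941888, 4563677184, 2290225152, 9127354368, 17197744128, 34395488256, 1145241600]) (posList 36 cert.HX) 4 9 27 = true := by decide +kernel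

end Summit.Ventures.QEC.Census.LP36w5
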